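import Summits.QuantumFields.BalabanUV.T4Continuum.Support.NE7K1LinWalkLinePad
import Summits.QuantumFields.BalabanUV.T4Continuum.Support.NE7K1LinWalkLineRegion

/-!
# NE7K1LinWalkLineDelta — row NE7 (node U5), candidate route HOM, path H1L, cell K1-lin(s): B4's `δG` CLAUSE (1.11)–(1.12) FOR THE TWO-CUTOFF
# LINE AT U = 1 IN KERNEL — `(twoCutoffLine_Ω s)⁻¹ − (twoCutoffLine_{Ω₀} s)⁻¹` DECAYS GEOMETRICALLY IN THE NUMBER OF `M`-CUBE STEPS FROM `x`
# THROUGH `Ω₀ ∖ Ω` TO `y`, UNIFORMLY IN `s ∈ [0,1]`, IN THE MESH AND IN THE REGIONS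

Lineage `b2b-balaban-t4-ne7-p2` (CRUX PROVER NE7 #2), generation 71; series (RW) file 27 = the assembly of files 22 (`NE7K1LinWalkDelta`, the
abstract `δG` clause), 25 (`NE7K1LinWalkPadE`, padding along an injection), 26 (`NE7K1LinWalkLinePad`, the line's entry agreement) on the line's
walk data of files 14 ∕ 20 (`NE7K1LinWalkLineWalk`, `NE7K1LinWalkLineRegion`).  [Balaban1983RegularityDecay] = T. Bałaban, Commun. Math. Phys. 89
(1983) 571–597, p. 573 (1.11)–(1.12) and p. 581 «The same inequalities hold for δG_k(Ω,Ω₀,A)» — here for the K1-lin(s) LINE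
`T(s) = (1−s)P_A + s·P_B^{Schur}` (ROUTES-NE7 §L1.1: «K1-lin(s) = B4 §2's construction run for P(s)»), whose walk runs on the ψ-rescaled
extended operator `𝒫♮(s)` (file 9) and is read off on the coarse block (`NE7K1LinWalkLine.extLine_inv_inl_inl`).

THE SETTING.  Mesh `1∕n` of run A, refinement `L`, cube scale `M ≥ 3`, labels `J ∈ Π_μ{0..K_μ}`; two fine regions `R′ ⊆ R′₀`, unions of
`nL`-blocks, whose coarse sites are regions `R′.image (blk L) = reg (Mn) K C`, `R′₀.image (blk L) = reg (Mn) K C₀` (file 18); `a > 0`,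
`s ∈ [0,1]`.  The walk data are `Ω₀`'s (cut-offs `cut (Mn) J ∘ site`, lifted regions, file 14), the operator pair is (`padE ψ 𝒫♮_Ω(s)`,
`𝒫♮_{Ω₀}(s)`) on `Idx L R′₀`.

* §1 `padLine_data`: the padded `𝒫♮_Ω(s)` is `min(σ♮,1)`-coercive (`padE_coercive` + `extLine_coercive'`), its cut-offs live on their regions
  (`cutoffOn_padE` + Ω's OWN `cutoffOn_line` through preimages — the line's off-diagonal entries near `∂Ω` do NOT agree, so file 23's route is not
  available), (H-comm) with the line's constants `α♮, β♮` BY NAME (`hcomm_padE` + `hcomm_line_region`), remainder `≤ 3^{d+1}τ♮`.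
* §2 **`twoCutoffLine_inv_sub_inv_entry_decay_region`** — B4 (1.11)–(1.12) FOR THE LINE: for `3^{d+1}τ♮ < 1` (`τ♮ = lineTau d L M a`, file 14's
  threshold, UNCHANGED), every `s ∈ [0,1]`, and coarse sites `x, y ∈ Ω` such that every defect site `z ∈ Ω₀ ∖ Ω` admits `N₀ + N₁ ≥ N ≥ 1` with
  (`N₀ = 0` or `|x_μ − z_μ| ≥ (2N₀+3)Mn + n + 1` for some `μ`) and (`N₁ = 0` or `|z_ν − y_ν| ≥ (2N₁+3)Mn + 2n + 1` for some `ν`):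
  `|(T_Ω(s)⁻¹)(x,y) − (T_{Ω₀}(s)⁻¹)(x,y)| ≤ 2·3^{d+1}·(min(σ♮,1))⁻¹·τ♮·3^{d+1}·(3^{d+1}τ♮)^{N−1}∕(1 − 3^{d+1}τ♮)` — constants FREE of `s`, of the
  mesh and of the regions; `…_depth` (one depth for `x`, one for `y`); `…_fineRegion`: the concrete fine regions `fineDom L (reg (Mn) K C) ⊆ fineDom L (reg (Mn) K C₀)` for `C ⊆ C₀`.

HONEST FRAMING: [folklore] assembly; A = 0 (Gaussian level), U = 1, ONE scale, crude explicit constants unchanged; the Hölder (1.9) version, A ≠ 0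
and the multi-scale factor are not touched; nothing of Bałaban's asserted; no `sorry`.  Census only (cell K1-lin(s)'s «template application»,
random-walk half: the `δG` clause now for the endpoint AND the two-cutoff line); NO letter ∕ tag ∕ size of NE7 moves; NE7 NOT PRINTED ∕ NOT
PROVED; spine 0∕9; FIXED FINITE T⁴, rung (B)+1; NOT infinite volume, NOT mass gap, NOT Clay.  HONEST DEPENDENCY: continuum YM on T⁴ ⇐ BetaPertH
∧ nine spine estimates (0/9 proved); BetaPertH ⇐ (D1) ∧ (D4) ∧ CAP+tail; G-an2-4 gates asym, D1 and NE2/3/4.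
-/

noncomputable section

open Finset Matrix
open scoped Matrix.Norms.L2Operator

namespace Summit.QuantumFields.BalabanUV.T4Continuum.NE7K1LinWalkLineDelta

open Literature.MathematicalPhysics.QuantumFieldTheory.Balaban1983to89
open Literature.MathematicalPhysics.QuantumFieldTheory.Balaban1983to89.B4Reflection242
open Literature.MathematicalPhysics.QuantumFieldTheory.Balaban1983to89.B4BoxCov237
open Literature.MathematicalPhysics.QuantumFieldTheory.Balaban1983to89.B4Lower18
open NE7K1LinSchurLineForm NE7K1LinBlockCoords NE7K1LinSchurLineU1 NE7K1LinWalkParametrix NE7K1LinWalkSmallness NE7K1LinWalkExpansion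
  NE7K1LinWalkCubes NE7K1LinWalkBox NE7K1LinWalkFineOp NE7K1LinWalkLine NE7K1LinWalkLineHcomm NE7K1LinWalkLineWalk NE7K1LinWalkLineRegion
  NE7K1LinWalkRegion NE7K1LinWalkDelta NE7K1LinWalkPad NE7K1LinWalkPadE NE7K1LinWalkDeltaRegion NE7K1LinWalkLinePad

variable {d : ℕ}

section Instance

variable {n L M : ℕ} [NeZero L] {R' R'₀ : Finset (Fin (d + 1) → ℤ)} (K : Fin (d + 1) → ℕ) (C C₀ : Finset (Fin (d + 1) → ℤ))

/-! ### §1 The data checks of the padded line operator on `Ω₀`'s cut-off system -/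

/-- partition of unity `Σ_J Λ_J r_J ≡ 1` on `Idx` over a region (the coarse PoU at `site c`; file 20's private step re-proved). [folklore] -/
private theorem sum_cut_mul_ind_lineRegion (hreg₀ : R'₀.image (blk L) = reg (M * n) K C₀) (hW : 1 ≤ M * n) (c : Idx L R'₀) :
    ∑ J : Lab K, cut (M * n) J.1 (site c).1 *
      (if c ∈ univ.filter (fun c : Idx L R'₀ => site c ∈ region (R'₀.image (blk L)) (M * n) n J.1) then (1 : ℝ) else 0) = 1 := by
  have h1 : ∀ J : Lab K, cut (M * n) J.1 (site c).1 *
      (if c ∈ univ.filter (fun c : Idx L R'₀ => site c ∈ region (R'₀.image (blk L)) (M * n) n J.1) then (1 : ℝ) else 0) =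
      cut (M * n) J.1 (site c).1 := by
    intro J
    by_cases h : cut (M * n) J.1 (site c).1 = 0
    · rw [h, zero_mul]
    · rw [if_pos (show c ∈ univ.filter (fun c : Idx L R'₀ => site c ∈ region (R'₀.image (blk L)) (M * n) n J.1) from
        Finset.mem_filter.2 ⟨Finset.mem_univ _, mem_region_self_of_cut_ne_zero hW h⟩), mul_one]
  simp_rw [h1]
  have hx : (site c).1 ∈ reg (M * n) K C₀ := by rw [← hreg₀]; exact (site c).2
  rw [Finset.sum_coe_sort (labs K) (fun J' => cut (M * n) J' (site c).1)]
  exact sum_cut_eq_one_region hW K C₀ hx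

/-- the padded `𝒫♮_Ω(s)` on `Idx L R′₀`: coercivity `min(σ♮,1)`, cut-offs live on their regions, (H-comm) with the line's constants, and the
remainder is small `‖R‖ ≤ 3^{d+1}τ♮`. [folklore] -/
theorem padLine_data (hn : 1 ≤ n) (hM : 3 ≤ M) (hR' : IsBlockUnion (n * L) R') (hR'₀ : IsBlockUnion (n * L) R'₀) (hsub : R' ⊆ R'₀)
    (hreg : R'.image (blk L) = reg (M * n) K C) {a : ℝ} (ha : 0 < a) {s : ℝ} (hs0 : 0 ≤ s) (hs1 : s ≤ 1) :
    (∀ w : Idx L R'₀ → ℝ, min (lineSigma d L a) 1 * (w ⬝ᵥ w) ≤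
        w ⬝ᵥ padE (psiL R') (extLine (isBlockUnion_fine hR') n a s) *ᵥ w) ∧
      (∀ J : Lab K, CutoffOn (padE (psiL R') (extLine (isBlockUnion_fine hR') n a s))
        (fun c : Idx L R'₀ => cut (M * n) J.1 (site c).1)
        (univ.filter fun c : Idx L R'₀ => site c ∈ region (R'₀.image (blk L)) (M * n) n J.1)) ∧
      (∀ (J : Lab K) (v : Idx L R'₀ → ℝ),
        comm (fun c : Idx L R'₀ => cut (M * n) J.1 (site c).1) (padE (psiL R') (extLine (isBlockUnion_fine hR') n a s)) *ᵥ v ⬝ᵥ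
            comm (fun c : Idx L R'₀ => cut (M * n) J.1 (site c).1) (padE (psiL R') (extLine (isBlockUnion_fine hR') n a s)) *ᵥ v ≤
          lineAlpha2 d L M * (v ⬝ᵥ padE (psiL R') (extLine (isBlockUnion_fine hR') n a s) *ᵥ v) + lineBeta2 d L M a * (v ⬝ᵥ v)) ∧
      ‖∑ J : Lab K, bPiece (padE (psiL R') (extLine (isBlockUnion_fine hR') n a s)) (fun c : Idx L R'₀ => cut (M * n) J.1 (site c).1)
          (fun c => if c ∈ univ.filter (fun c : Idx L R'₀ => site c ∈ region (R'₀.image (blk L)) (M * n) n J.1) then (1 : ℝ) else 0)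
          (univ.filter fun c : Idx L R'₀ => site c ∈ region (R'₀.image (blk L)) (M * n) n J.1)‖ ≤ (3 : ℝ) ^ (d + 1) * lineTau d L M a := by
  classical
  obtain ⟨hW, hW2, hρ⟩ := scale_facts hn hM
  have hM0 : (0 : ℝ) < M := Nat.cast_pos.2 (by omega)
  have hsubC : R'.image (blk L) ⊆ R'₀.image (blk L) := Finset.image_subset_image hsub
  have hψφ := psiL_phiL hsubC (R' := R')
  have hφψ := phiL_psiL hsubC (R' := R')
  set Q : Matrix (Idx L R'₀) (Idx L R'₀) ℝ := padE (psiL R') (extLine (isBlockUnion_fine hR') n a s) with hQ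
  have hQc : ∀ w : Idx L R'₀ → ℝ, min (lineSigma d L a) 1 * (w ⬝ᵥ w) ≤ w ⬝ᵥ Q *ᵥ w :=
    padE_coercive hψφ hφψ _ (extLine_coercive' hn hR' ha hs0 hs1)
  -- the pulled-back cut-off data are `Ω`'s own
  have hlφ : ∀ J : Lab K, (fun c : Idx L R'₀ => cut (M * n) J.1 (site c).1) ∘ phiL hsubC =
      fun c : Idx L R' => cut (M * n) J.1 (site c).1 := fun J => by
    funext c
    simp only [Function.comp_apply, site_phiL]
    rfl
  have hcutQ : ∀ J : Lab K, CutoffOn Q (fun c : Idx L R'₀ => cut (M * n) J.1 (site c).1)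
      (univ.filter fun c : Idx L R'₀ => site c ∈ region (R'₀.image (blk L)) (M * n) n J.1) := fun J =>
    cutoffOn_padE hφψ (cutoffOn_line (a := a) (s := s) K hn hR'₀ hW J).1 (by
      rw [hlφ]
      obtain ⟨h1, h2⟩ := cutoffOn_line (M := M) (s := s) K hn hR' hW J (a := a)
      refine ⟨fun c hc => ?_, fun c c' hc hc' => h2 c c' hc fun h => hc' ?_⟩
      · have h := h1 c hc
        simp only [Finset.mem_filter, Finset.mem_univ, true_and, site_phiL, mem_region] at h ⊢
        exact h
      · simp only [Finset.mem_filter, Finset.mem_univ, true_and, site_phiL, mem_region] at h ⊢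
        exact h)
  have hα : 0 ≤ lineAlpha2 d L M := by unfold lineAlpha2; positivity
  have hβ : 0 ≤ lineBeta2 d L M a := by unfold lineBeta2; positivity
  have hcommQ : ∀ (J : Lab K) (v : Idx L R'₀ → ℝ),
      comm (fun c : Idx L R'₀ => cut (M * n) J.1 (site c).1) Q *ᵥ v ⬝ᵥ comm (fun c : Idx L R'₀ => cut (M * n) J.1 (site c).1) Q *ᵥ v ≤
        lineAlpha2 d L M * (v ⬝ᵥ Q *ᵥ v) + lineBeta2 d L M a * (v ⬝ᵥ v) := fun J v =>
    hcomm_padE hψφ hφψ _ _ (lineSigma_pos ha).le (extLine_coercive' hn hR' ha hs0 hs1) hα hβ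
      (by rw [hlφ]; exact hcomm_line_region K C hn hM hR' hreg ha hs0 hs1 J) v
  refine ⟨hQc, hcutQ, hcommQ, ?_⟩
  have hσ : 0 < min (lineSigma d L a) 1 := lt_min (lineSigma_pos ha) one_pos
  have h := l2_opNorm_remainder_le Q hσ hQc (fun J : Lab K => fun c : Idx L R'₀ => cut (M * n) J.1 (site c).1)
    (fun J c => if c ∈ univ.filter (fun c : Idx L R'₀ => site c ∈ region (R'₀.image (blk L)) (M * n) n J.1) then (1 : ℝ) else 0)
    (fun J => univ.filter fun c : Idx L R'₀ => site c ∈ region (R'₀.image (blk L)) (M * n) n J.1)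
    hcutQ (fun J c => (cut_ind_bounds_line K J c).2.2) (fun J c => (cut_ind_bounds_line K J c).2.1) hα hβ hcommQ
    (fun J => count_overlap_line K hρ _ (fun J c hc => (Finset.mem_filter.1 hc).2) J) fun c => (count_cover_line K hW hρ c).1
  refine h.trans (le_of_eq ?_)
  have hmin : min (min (lineSigma d L a) 1) 1 = min (lineSigma d L a) 1 := min_eq_left (min_le_right _ _)
  rw [hmin, lineTau, ← Real.sqrt_sq (by positivity : (0 : ℝ) ≤ (3 : ℝ) ^ (d + 1)), ← Real.sqrt_mul (by positivity)]
  congr 1; push_cast; ring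

/-! ### §2 B4 (1.11)–(1.12) for the two-cutoff line -/

/-- **B4's `δG` CLAUSE (1.11)–(1.12) ∕ COROLLARY 2.3 FOR THE K1-lin(s) TWO-CUTOFF LINE AT U = 1, UNIFORMLY IN `s`, IN THE MESH AND IN THE
REGIONS.**  For `n ≥ 1`, `M ≥ 3`, fine regions `R′ ⊆ R′₀` (unions of `nL`-blocks) over the coarse regions `reg (Mn) K C` and `reg (Mn) K C₀`,
`a > 0`, `s ∈ [0,1]`, `3^{d+1}τ♮ < 1`, and coarse sites `x, y` of `R′` such that EVERY defect site `z` (a coarse site of `R′₀` not of `R′`)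
admits `N₀ + N₁ ≥ N ≥ 1` with (`N₀ = 0` or `|x_μ − z_μ| ≥ (2N₀+3)Mn + (n+1)` for some `μ`) and (`N₁ = 0` or
`|z_ν − y_ν| ≥ (2N₁+3)Mn + (n+1) + n` for some `ν`):
`|(twoCutoffLine_{R′} s)⁻¹(x,y) − (twoCutoffLine_{R′₀} s)⁻¹(x,y)| ≤ 2·3^{d+1}·(min(σ♮,1))⁻¹·τ♮·3^{d+1}·(3^{d+1}τ♮)^{N−1}∕(1 − 3^{d+1}τ♮)`.
[cite: Balaban1983RegularityDecay, (1.11)–(1.12) p.573, p.579 after (2.22), Corollary 2.3 p.581, case A = 0, shape] [folklore] -/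
theorem twoCutoffLine_inv_sub_inv_entry_decay_region (hn : 1 ≤ n) (hM : 3 ≤ M) (hR' : IsBlockUnion (n * L) R')
    (hR'₀ : IsBlockUnion (n * L) R'₀) (hsub : R' ⊆ R'₀) (hreg : R'.image (blk L) = reg (M * n) K C)
    (hreg₀ : R'₀.image (blk L) = reg (M * n) K C₀) {a : ℝ} (ha : 0 < a) {s : ℝ} (hs0 : 0 ≤ s) (hs1 : s ≤ 1)
    (hsmall : (3 : ℝ) ^ (d + 1) * lineTau d L M a < 1) (x y : ↥(R'.image (blk L))) {N : ℕ} (hN : 1 ≤ N)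
    (hsepT : ∀ z : ↥(R'₀.image (blk L)), z.1 ∉ R'.image (blk L) → ∃ N₀ N₁, N ≤ N₀ + N₁ ∧
      (N₀ = 0 ∨ ∃ μ, (((2 * N₀ + 3) * (M * n) + (n + 1) : ℕ) : ℤ) ≤ |x.1 μ - z.1 μ|) ∧
      (N₁ = 0 ∨ ∃ ν, (((2 * N₁ + 3) * (M * n) + (n + 1) + n : ℕ) : ℤ) ≤ |z.1 ν - y.1 ν|)) :
    |(twoCutoffLine (isBlockUnion_fine hR') n a s)⁻¹ x y -
        (twoCutoffLine (isBlockUnion_fine hR'₀) n a s)⁻¹ (incl (Finset.image_subset_image hsub) x)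
          (incl (Finset.image_subset_image hsub) y)| ≤
      2 * ((3 : ℝ) ^ (d + 1) * (1 / min (lineSigma d L a) 1) * lineTau d L M a * (3 : ℝ) ^ (d + 1) *
        ((3 : ℝ) ^ (d + 1) * lineTau d L M a) ^ (N - 1) / (1 - (3 : ℝ) ^ (d + 1) * lineTau d L M a)) := by
  classical
  obtain ⟨hW, hW2, hρ⟩ := scale_facts hn hM
  have hM0 : (0 : ℝ) < M := Nat.cast_pos.2 (by omega)
  have hsubC : R'.image (blk L) ⊆ R'₀.image (blk L) := Finset.image_subset_image hsub
  have hψφ := psiL_phiL hsubC (R' := R')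
  have hφψ := phiL_psiL hsubC (R' := R')
  obtain ⟨hQc, hcutQ, hcommQ, hRQ⟩ := padLine_data K C hn hM hR' hR'₀ hsub hreg ha hs0 hs1
  have hσ : 0 < min (lineSigma d L a) 1 := lt_min (lineSigma_pos ha) one_pos
  have hP₀c : ∀ w, min (lineSigma d L a) 1 * (w ⬝ᵥ w) ≤ w ⬝ᵥ extLine (isBlockUnion_fine hR'₀) n a s *ᵥ w := fun w =>
    (mul_le_mul_of_nonneg_right (min_le_left _ _) (Finset.sum_nonneg fun i _ => mul_self_nonneg _)).trans
      (extLine_coercive' hn hR'₀ ha hs0 hs1 w)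
  have hα : 0 ≤ lineAlpha2 d L M := by unfold lineAlpha2; positivity
  have hβ : 0 ≤ lineBeta2 d L M a := by unfold lineBeta2; positivity
  have hmin : min (min (lineSigma d L a) 1) 1 = min (lineSigma d L a) 1 := min_eq_left (min_le_right _ _)
  have hsmall' : (3 : ℝ) ^ (d + 1) * Real.sqrt (lineAlpha2 d L M / min (min (lineSigma d L a) 1) 1 +
      lineBeta2 d L M a / (min (min (lineSigma d L a) 1) 1) ^ 2) < 1 := by
    rw [hmin]; rw [lineTau] at hsmall; exact hsmall
  -- the agreement off the boundary labels and the length restriction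
  have hagree : ∀ J ∉ bdryLab (M * n) n K (R'.image (blk L)) (R'₀.image (blk L)),
      ∀ x' ∈ univ.filter (fun c : Idx L R'₀ => site c ∈ region (R'₀.image (blk L)) (M * n) n J.1),
      ∀ y' ∈ univ.filter (fun c : Idx L R'₀ => site c ∈ region (R'₀.image (blk L)) (M * n) n J.1),
      padE (psiL R') (extLine (isBlockUnion_fine hR') n a s) x' y' = extLine (isBlockUnion_fine hR'₀) n a s x' y' :=
    fun J hJ x' hx' y' hy' => padE_extLine_agree (isBlockUnion_fine hR') (isBlockUnion_fine hR'₀) hsub n a s K hJ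
      x' (Finset.mem_filter.1 hx').2 y' (Finset.mem_filter.1 hy').2
  have hsepT' : ∀ J : Lab K, (fun c : Idx L R'₀ => cut (M * n) J.1 (site c).1) (Sum.inl (incl hsubC x)) ≠ 0 →
      ∀ t ∈ bdryLab (M * n) n K (R'.image (blk L)) (R'₀.image (blk L)), ∀ k : Lab K,
      (fun c => if c ∈ univ.filter (fun c : Idx L R'₀ => site c ∈ region (R'₀.image (blk L)) (M * n) n k.1) then (1 : ℝ) else 0)
        (Sum.inl (incl hsubC y)) ≠ 0 →
      ∃ μ μ', (N : ℤ) ≤ |labPos K J μ - labPos K t μ| + |labPos K t μ' - labPos K k μ'| :=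
    fun J hJ t ht k hk => label_sep_through K hW hsubC hsepT hJ ht
      (Finset.mem_filter.1 (((cut_ind_bounds_line K k (Sum.inl (incl hsubC y))).2.2) hk)).2
  have hmain := inv_sub_inv_entry_decay (labPos K) (labPos_injective K)
    (padE (psiL R') (extLine (isBlockUnion_fine hR') n a s)) (extLine (isBlockUnion_fine hR'₀) n a s) hσ hQc hP₀c
    (fun J : Lab K => fun c : Idx L R'₀ => cut (M * n) J.1 (site c).1)
    (fun J c => if c ∈ univ.filter (fun c : Idx L R'₀ => site c ∈ region (R'₀.image (blk L)) (M * n) n J.1) then (1 : ℝ) else 0)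
    (fun J => univ.filter fun c : Idx L R'₀ => site c ∈ region (R'₀.image (blk L)) (M * n) n J.1)
    (fun J J' hJJ' => disjoint_line K hρ hJJ') hcutQ (cutoffOn_line K hn hR'₀ hW) (sum_cut_mul_ind_lineRegion K C₀ hreg₀ hW)
    zero_le_one (fun J c => (cut_ind_bounds_line K J c).1) (fun J c => (cut_ind_bounds_line K J c).2.2)
    (fun J c => (cut_ind_bounds_line K J c).2.1) hα hβ hcommQ (hcomm_line_region K C₀ hn hM hR'₀ hreg₀ ha hs0 hs1) hsmall'
    (hRQ.trans_lt hsmall) ((l2_opNorm_remainder_line_region K C₀ hn hM hR'₀ hreg₀ ha hs0 hs1).trans_lt hsmall)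
    (bdryLab (M * n) n K (R'.image (blk L)) (R'₀.image (blk L))) hagree (Sum.inl (incl hsubC x)) (Sum.inl (incl hsubC y))
    (count_cover_line K hW hρ (Sum.inl (incl hsubC x))).2 hN hsepT'
  -- read off on the coarse block
  have hPinv : extLine (isBlockUnion_fine hR') n a s * (extLine (isBlockUnion_fine hR') n a s)⁻¹ = 1 :=
    mul_nonsing_inv _ (isUnit_det_of_coercive _ (lineSigma_pos ha) (extLine_coercive' hn hR' ha hs0 hs1))
  have e1 : padE (psiL R') (extLine (isBlockUnion_fine hR') n a s)⁻¹ (Sum.inl (incl hsubC x)) (Sum.inl (incl hsubC y)) =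
      (extLine (isBlockUnion_fine hR') n a s)⁻¹ (Sum.inl x) (Sum.inl y) :=
    padE_phi hψφ (extLine (isBlockUnion_fine hR') n a s)⁻¹ (Sum.inl x) (Sum.inl y)
  have hent : ((padE (psiL R') (extLine (isBlockUnion_fine hR') n a s))⁻¹ - (extLine (isBlockUnion_fine hR'₀) n a s)⁻¹ :
      Matrix (Idx L R'₀) (Idx L R'₀) ℝ) (Sum.inl (incl hsubC x)) (Sum.inl (incl hsubC y)) =
      (twoCutoffLine (isBlockUnion_fine hR') n a s)⁻¹ x y -
        (twoCutoffLine (isBlockUnion_fine hR'₀) n a s)⁻¹ (incl hsubC x) (incl hsubC y) := by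
    rw [Matrix.sub_apply, padE_inv hψφ hφψ hPinv, e1, extLine_inv_inl_inl hn hR' ha hs0 x y,
      extLine_inv_inl_inl hn hR'₀ ha hs0 (incl hsubC x) (incl hsubC y)]
  rw [hent, hmin] at hmain
  rw [lineTau]
  refine hmain.trans (le_of_eq ?_)
  push_cast
  ring

/-- **THE (1.12) FORM WITH TWO DEPTHS, FOR THE LINE**: `x` is `N₀` cube steps deep and `y` is `N₁` steps deep with respect to the defect sites
(`N₀ + N₁ ≥ 1`) ⇒ the bound with `N = N₀ + N₁` — the printed «additional factor exp(−δ₀dist(x,Ωᶜ) − δ₀dist(supp f,Ωᶜ))» in cube steps, every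
`s ∈ [0,1]`. [cite: Balaban1983RegularityDecay, (1.12) p.573, Corollary 2.3 p.581, case A = 0, shape] [folklore] -/
theorem twoCutoffLine_inv_sub_inv_entry_decay_depth (hn : 1 ≤ n) (hM : 3 ≤ M) (hR' : IsBlockUnion (n * L) R')
    (hR'₀ : IsBlockUnion (n * L) R'₀) (hsub : R' ⊆ R'₀) (hreg : R'.image (blk L) = reg (M * n) K C)
    (hreg₀ : R'₀.image (blk L) = reg (M * n) K C₀) {a : ℝ} (ha : 0 < a) {s : ℝ} (hs0 : 0 ≤ s) (hs1 : s ≤ 1)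
    (hsmall : (3 : ℝ) ^ (d + 1) * lineTau d L M a < 1) (x y : ↥(R'.image (blk L))) {N₀ N₁ : ℕ} (hN : 1 ≤ N₀ + N₁)
    (hx : N₀ = 0 ∨ ∀ z : ↥(R'₀.image (blk L)), z.1 ∉ R'.image (blk L) →
      ∃ μ, (((2 * N₀ + 3) * (M * n) + (n + 1) : ℕ) : ℤ) ≤ |x.1 μ - z.1 μ|)
    (hy : N₁ = 0 ∨ ∀ z : ↥(R'₀.image (blk L)), z.1 ∉ R'.image (blk L) →
      ∃ ν, (((2 * N₁ + 3) * (M * n) + (n + 1) + n : ℕ) : ℤ) ≤ |z.1 ν - y.1 ν|) :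
    |(twoCutoffLine (isBlockUnion_fine hR') n a s)⁻¹ x y -
        (twoCutoffLine (isBlockUnion_fine hR'₀) n a s)⁻¹ (incl (Finset.image_subset_image hsub) x)
          (incl (Finset.image_subset_image hsub) y)| ≤
      2 * ((3 : ℝ) ^ (d + 1) * (1 / min (lineSigma d L a) 1) * lineTau d L M a * (3 : ℝ) ^ (d + 1) *
        ((3 : ℝ) ^ (d + 1) * lineTau d L M a) ^ (N₀ + N₁ - 1) / (1 - (3 : ℝ) ^ (d + 1) * lineTau d L M a)) :=
  twoCutoffLine_inv_sub_inv_entry_decay_region K C C₀ hn hM hR' hR'₀ hsub hreg hreg₀ ha hs0 hs1 hsmall x y hN fun z hz =>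
    ⟨N₀, N₁, le_rfl, hx.imp id fun h => h z hz, hy.imp id fun h => h z hz⟩

end Instance

/-! ### §3 The concrete fine regions over two coarse regions -/

section Concrete

variable {n L M : ℕ} [NeZero L] (K : Fin (d + 1) → ℕ) {C C₀ : Finset (Fin (d + 1) → ℤ)}

/-- monotonicity of the fine region in its coarse sites. [folklore] -/
theorem fineDom_mono {Ω Ω₀ : Finset (Fin (d + 1) → ℤ)} (h : Ω ⊆ Ω₀) : fineDom L Ω ⊆ fineDom L Ω₀ := fun x hx => by
  rw [mem_fineDom NeZero.one_le] at hx ⊢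
  exact h hx

/-- **B4's `δG` CLAUSE FOR THE K1-lin(s) LINE ON THE FINE REGIONS OVER TWO COARSE REGIONS `reg (Mn) K C ⊆ reg (Mn) K C₀`** (`C ⊆ C₀`): for
`n ≥ 1`, `M ≥ 3`, `a > 0`, `s ∈ [0,1]`, `3^{d+1}τ♮ < 1` and coarse sites `x, y` with the length restriction through the defect sites as in
`twoCutoffLine_inv_sub_inv_entry_decay_region`: the same bound, every constant free of `s`, of the mesh and of the regions.
[cite: Balaban1983RegularityDecay, (1.11)–(1.12) p.573, Corollary 2.3 p.581, case A = 0, shape] [folklore] -/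
theorem twoCutoffLine_inv_sub_inv_entry_decay_fineRegion (hn : 1 ≤ n) (hM : 3 ≤ M) (hC : C ⊆ C₀) {a : ℝ} (ha : 0 < a)
    {s : ℝ} (hs0 : 0 ≤ s) (hs1 : s ≤ 1) (hsmall : (3 : ℝ) ^ (d + 1) * lineTau d L M a < 1)
    (x y : ↥((fineDom L (reg (M * n) K C)).image (blk L))) {N : ℕ} (hN : 1 ≤ N)
    (hsepT : ∀ z : ↥((fineDom L (reg (M * n) K C₀)).image (blk L)), z.1 ∉ (fineDom L (reg (M * n) K C)).image (blk L) →
      ∃ N₀ N₁, N ≤ N₀ + N₁ ∧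
      (N₀ = 0 ∨ ∃ μ, (((2 * N₀ + 3) * (M * n) + (n + 1) : ℕ) : ℤ) ≤ |x.1 μ - z.1 μ|) ∧
      (N₁ = 0 ∨ ∃ ν, (((2 * N₁ + 3) * (M * n) + (n + 1) + n : ℕ) : ℤ) ≤ |z.1 ν - y.1 ν|)) :
    |(twoCutoffLine (isBlockUnion_fine (isBlockUnion_lineRegion K C hn M)) n a s)⁻¹ x y -
        (twoCutoffLine (isBlockUnion_fine (isBlockUnion_lineRegion K C₀ hn M)) n a s)⁻¹
          (incl (Finset.image_subset_image (fineDom_mono (reg_mono (M * n) K hC))) x)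
          (incl (Finset.image_subset_image (fineDom_mono (reg_mono (M * n) K hC))) y)| ≤
      2 * ((3 : ℝ) ^ (d + 1) * (1 / min (lineSigma d L a) 1) * lineTau d L M a * (3 : ℝ) ^ (d + 1) *
        ((3 : ℝ) ^ (d + 1) * lineTau d L M a) ^ (N - 1) / (1 - (3 : ℝ) ^ (d + 1) * lineTau d L M a)) :=
  twoCutoffLine_inv_sub_inv_entry_decay_region K C C₀ hn hM (isBlockUnion_lineRegion K C hn M) (isBlockUnion_lineRegion K C₀ hn M)
    (fineDom_mono (reg_mono (M * n) K hC)) (image_blk_lineRegion K C n M) (image_blk_lineRegion K C₀ n M) ha hs0 hs1 hsmall x y hN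
    hsepT

end Concrete

/-! ### §4 The exponential form (gen 71, appended) -/

section Exp

variable {n L M : ℕ} [NeZero L] {R' R'₀ : Finset (Fin (d + 1) → ℤ)} (K : Fin (d + 1) → ℕ) (C C₀ : Finset (Fin (d + 1) → ℤ))

/-- **THE LINE'S (1.12) IN EXPONENTIAL FORM**: if moreover `3^{d+1}τ♮ ≤ e^{−δ}` (`δ > 0`), the two-depth bound reads
`2·3^{d+1}σ♮′⁻¹τ♮·3^{d+1}∕(1 − e^{−δ}) · e^{−δ(N₀+N₁−1)}` — the printed exponential factor of (1.12) in cube steps, every `s ∈ [0,1]`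
(file 22's `geom_le_exp`). [cite: Balaban1983RegularityDecay, (1.12) p.573, Corollary 2.3 (2.30) pp.580–581, case A = 0, shape] [folklore] -/
theorem twoCutoffLine_inv_sub_inv_entry_decay_depth_exp (hn : 1 ≤ n) (hM : 3 ≤ M) (hR' : IsBlockUnion (n * L) R')
    (hR'₀ : IsBlockUnion (n * L) R'₀) (hsub : R' ⊆ R'₀) (hreg : R'.image (blk L) = reg (M * n) K C)
    (hreg₀ : R'₀.image (blk L) = reg (M * n) K C₀) {a : ℝ} (ha : 0 < a) {s : ℝ} (hs0 : 0 ≤ s) (hs1 : s ≤ 1) {δ : ℝ} (hδ : 0 < δ)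
    (hsmall : (3 : ℝ) ^ (d + 1) * lineTau d L M a ≤ Real.exp (-δ)) (x y : ↥(R'.image (blk L))) {N₀ N₁ : ℕ} (hN : 1 ≤ N₀ + N₁)
    (hx : N₀ = 0 ∨ ∀ z : ↥(R'₀.image (blk L)), z.1 ∉ R'.image (blk L) →
      ∃ μ, (((2 * N₀ + 3) * (M * n) + (n + 1) : ℕ) : ℤ) ≤ |x.1 μ - z.1 μ|)
    (hy : N₁ = 0 ∨ ∀ z : ↥(R'₀.image (blk L)), z.1 ∉ R'.image (blk L) →
      ∃ ν, (((2 * N₁ + 3) * (M * n) + (n + 1) + n : ℕ) : ℤ) ≤ |z.1 ν - y.1 ν|) :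
    |(twoCutoffLine (isBlockUnion_fine hR') n a s)⁻¹ x y -
        (twoCutoffLine (isBlockUnion_fine hR'₀) n a s)⁻¹ (incl (Finset.image_subset_image hsub) x)
          (incl (Finset.image_subset_image hsub) y)| ≤
      2 * ((3 : ℝ) ^ (d + 1) * (1 / min (lineSigma d L a) 1) * lineTau d L M a * (3 : ℝ) ^ (d + 1) / (1 - Real.exp (-δ)) *
        Real.exp (-(δ * ((N₀ + N₁ - 1 : ℕ) : ℝ)))) := by
  have he1 : Real.exp (-δ) < 1 := Real.exp_lt_one_iff.mpr (neg_lt_zero.mpr hδ)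
  have hσ : 0 < min (lineSigma d L a) 1 := lt_min (lineSigma_pos ha) one_pos
  have hτ : 0 ≤ lineTau d L M a := Real.sqrt_nonneg _
  have h := twoCutoffLine_inv_sub_inv_entry_decay_depth K C C₀ hn hM hR' hR'₀ hsub hreg hreg₀ ha hs0 hs1 (hsmall.trans_lt he1) x y
    hN hx hy
  refine h.trans (mul_le_mul_of_nonneg_left ?_ (by norm_num))
  exact NE7K1LinWalkDelta.geom_le_exp (by positivity) (by positivity) hδ hsmall (N₀ + N₁)

end Exp

end Summit.QuantumFields.BalabanUV.T4Continuum.NE7K1LinWalkLineDelta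

end
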